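import Summits.BirchSwinnertonDyer.BirchSwinnertonDyer.Theorems.ErratumRoadFiveEulerHalfModularHGZOfAuxNorm
import Summits.BirchSwinnertonDyer.BirchSwinnertonDyer.Theorems.ErratumRoadFiveCarrierLocalE0OddPrime
import Summits.BirchSwinnertonDyer.BirchSwinnertonDyer.Theorems.ErratumRoadFiveNonSurjCornerTamagawaCarriers
import Literature.NumberTheory.EllipticCurves.LeadingTermTamagawaProofs
import Literature.NumberTheory.EllipticCurves.PAdicBSDSplitMultiplicativeProofs
import Literature.NumberTheory.EllipticCurves.RootNumberTwistProofs
import Literature.NumberTheory.EllipticCurves.TamagawaRingEquivProofs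
import Literature.NumberTheory.EllipticCurves.TamagawaFiniteIndexProofs
import HarnessLib

/-!
# The S1b branch's receptacle binder `hGZ` WITHOUT [GZ86 III (3.1)] — FULLY DISCHARGED at the split carrier `p` with `p ∣ c_p`
# (crux 19715 `EulerHalfNotRamNoInertSetAtFive`; item 27981 `EulerHalfGrossPrintFacts`: the S1b chain then needs ONLY conjunct 1)
# Cell `bsd-stepL`, seat `bsd-line-er5-p1-w5` g0; `--supports stmt-BirchSwinnertonDyer-19715 --as helper` (route-free)

WHAT. `hGZ_of_onlyMult` (and `hGZ_of_onlyMult_of_split_of_dvd_tamagawaProduct`, the same in the S1b stub's own binders `htam`∕`honly`∕`hsplit`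
via `dvd_localTamagawaNumber_padic_of_onlyMult_of_split_of_dvd_tamagawaProduct`): the conclusion of bsd-jet's ∕ bsd-potss' receptacle binder `hGZ` (`JET.hGZ_of_Gross1991`,
`HeegnerE0ImageFree.hGZ_of_Gross1991_imageFree_of_not_dvd_torsionOrder` — VERBATIM), on an S1b frame of crux 19715 — `W/ℚ` globally
minimal of conductor `N`, `K` imaginary quadratic with `d_K < −4` satisfying the Heegner hypothesis for `N`, `p ≥ 5` prime with `ρ̄_{E,p}`
onto, `p` the ONLY multiplicative prime of `E`, and `p ∣ c_p(E/ℚ_p)` — with NO named fact: the two local E₀-inputs (T), (C) at the carrier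
left as hypotheses by `ModularAuxNorm.hGZ_of_onlyMult_of_galTrivial_of_kills` are discharged by width seat -w6 g0's Kodaira–Néron port
`CarrierLocalE0OddPrime.carrierLocalE0_ringClassField_of_odd_prime_dvd` (tam3-p1 g18's p643818 ∕ p644399 from `3 ∣ c_q` to an odd prime
`p ∣ c_q`), `c := c_p(E/ℚ_p) ≠ 0` (`localTamagawaNumber_padic_ne_zero_holds`).

CONSUMER (RULING 70 (e), planner bsd-stepL g42): in place of `forall_hGZ_of_Gross1991 hF1 W K hK hD3 hD4 hHN p hp2 hρ Dt β ι` at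
`Theorems/ErratumRoadFiveJetchevAtPSupply.lean` l.220 — on the S1b locus (`…EulerHalfPOnlyMultOfPrint.stub_res_pOnlyMultCarrierAtFive_of_print`:
binders `honly`, `hsplit`, `p ∣ v_p(Δ_min)`; there `d_K` odd and `≠ −3` give `d_K < −4`, and split multiplicative with `p ∣ v_p(Δ_min) = c_p`
gives `p ∣ c_p`) — after which the S1b chain needs from item 27981 ONLY conjunct 1 (`GrossLMS1991.prop37_2_frobeniusCongruence`). The
re-thread (the extra binder `honly` inside the AtP frame) is the LEAD's ∕ planner's call and is NOT done here.

HONEST FRAMING: THEOREMS ONLY (no definition, no named fact, no instance, no `sorry`); every hypothesis is a frame condition of the S1b rows;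
removes no ITEM by itself; no stub ∕ item closes; 19715 is not closed by this; BSD is proved for no curve (T7); no summit statement is touched.
References (locators only): [cite: GrossLMS1991, §6, proof of Prop. 6.2 (1), p. 245; §3 Prop. 3.7 (1)] [cite: GrossZagier1986Heegner, III (3.1)
(p. 256) — the printed input this road avoids] [cite: SilvermanAEC2009, Thm. VII.6.1] [cite: SilvermanATAEC1994, IV Cor. 9.2 (d)].
presearch: as in `…ModularHGZOfAuxNorm` (none as a theorem in print without [GZ86 III (3.1)]). Axioms: `propext`, `Classical.choice`, `Quot.sound`.
-/

set_option autoImplicit false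
set_option linter.dupNamespace false

noncomputable section

open scoped Classical NumberField Pointwise

namespace Summit.BirchSwinnertonDyer.BirchSwinnertonDyer.Theorems.ModularAuxNorm

open WeierstrassCurve IsDedekindDomain NumberField Field Literature.NumberTheory.EllipticCurves
  Literature.NumberTheory.EllipticCurves.ModularForms
  Literature.NumberTheory.GaloisRepresentations
  Summit.BirchSwinnertonDyer.Rank1Residual.X11b Literature.NumberTheory.Automorphic
  Summit.BirchSwinnertonDyer.Rank1Residual.JET

/-- **`hGZ` on the S1b rows of crux 19715, WITHOUT [GZ86 III (3.1)] and with NO residual hypothesis.** For `W/ℚ` a global minimal model of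
conductor `N`, `K` imaginary quadratic with `d_K < −4` in which every prime dividing `N` splits, `p ≥ 5` a prime with `ρ̄_{E,p}` onto which is the
ONLY multiplicative prime of `E`, with `p ∣ c_p(E/ℚ_p)`, a modular parametrisation `Dt` of level `N`, ANY `β`, `ι : K → ℂ`: there is `n' ∈ ℤ`
prime to `p` such that for every square-free `m` with Zhang–Kolyvagin prime factors, every Kolyvagin–Heegner datum `dm` of level `m`, every
`γ ∈ Aut_ℚ(K[m])` and every bad place `v` of `E/K`: `n' • (γ y_m)_v ∈ E⁰(K̄_v)` and `n' • (γ y_{m/ℓ})_v ∈ E⁰(K̄_v)` (`ℓ ∣ m`, datum `dm'` read in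
`K[m]`) — VERBATIM the conclusion of `JET.hGZ_of_Gross1991` ∕ `HeegnerE0ImageFree.hGZ_of_Gross1991_imageFree_of_not_dvd_torsionOrder`.
(T), (C) at the carrier from `CarrierLocalE0OddPrime.carrierLocalE0_ringClassField_of_odd_prime_dvd`; the rest is
`hGZ_of_onlyMult_of_galTrivial_of_kills`. [cite: GrossLMS1991, §6, proof of Prop. 6.2 (1), p. 245] [cite: SilvermanAEC2009, Thm. VII.6.1] -/
theorem hGZ_of_onlyMult
    (W : WeierstrassCurve ℚ) [W.IsElliptic] [W.IsGloballyMinimal] [NeZero (W.conductorNorm ℤ)]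
    (K : Type) [Field K] [NumberField K] (hK : IsImaginaryQuadratic K) (hD : NumberField.discr K < -4)
    (hH : SatisfiesHeegnerHypothesis (W.conductorNorm ℤ) K) (p : ℕ) [Fact p.Prime] (hp5 : 5 ≤ p)
    (hsurj : W.HasSurjectiveModNGaloisRep p)
    (honly : ∀ (ℓ : ℕ) [Fact ℓ.Prime], W.HasMultiplicativeReductionAtPrime ℓ → ℓ = p)
    (hpc : p ∣ (W.baseChange ℚ_[p]).localTamagawaNumber ℤ_[p])
    (Dt : ModularParametrizationData W (W.conductorNorm ℤ)) (β : ℤ) (ι : K →+* ℂ)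
    [∀ j : ℕ, NumberField (ringClassField K ι j)] :
    ∃ n' : ℤ, IsCoprime (p : ℤ) n' ∧ ∀ (m : ℕ), Squarefree m →
      (∀ q ∈ m.primeFactors, Zhang2014.IsKolyvaginPrime (W.conductorNorm ℤ) W K p q) →
      ∀ (dm : KolyvaginHeegnerData Dt β ι m)
        (γ : ringClassField K ι m ≃ₐ[ℚ] ringClassField K ι m), γ ∈ ringClassGal ι m →
        ∀ v : HeightOneSpectrum (𝓞 K), ¬ (W.baseChange K).HasGoodReductionAt v →
          n' • pointsMap (W.baseChange K) (v.adicCompletion K)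
              (dm.toGeomPoints (pointGalHom W (ringClassField K ι m) γ dm.y)) ∈
            E0Receptacle (W.baseChange K) v ∧
          ∀ (ℓ : ℕ), ℓ ∈ m.primeFactors → ∀ (dm' : KolyvaginHeegnerData Dt β ι (m / ℓ))
            (hle : ringClassField K ι (m / ℓ) ≤ ringClassField K ι m),
            n' • pointsMap (W.baseChange K) (v.adicCompletion K)
                (dm.toGeomPoints (pointGalHom W (ringClassField K ι m) γ
                  (WeierstrassCurve.Affine.Point.map (W' := W)
                    ((RingClassField.inclusion ι hle).restrictScalars ℚ) dm'.y))) ∈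
              E0Receptacle (W.baseChange K) v := by
  have hp : p.Prime := Fact.out
  have hp2 : p ≠ 2 := by omega
  -- `p` is bad: at a good prime `c_p = 1` (`localTamagawaNumber_padic_eq_one_of_good_holds`), contradicting `p ∣ c_p`
  haveI : (W.baseChange ℚ_[p]).IsElliptic := inferInstanceAs (W.map (algebraMap ℚ ℚ_[p])).IsElliptic
  have hc0 : (W.baseChange ℚ_[p]).localTamagawaNumber ℤ_[p] ≠ 0 := localTamagawaNumber_padic_ne_zero_holds p (W.baseChange ℚ_[p])
  have hpN : p ∣ W.conductorNorm ℤ := by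
    by_contra hgoodN
    have hgood : W.HasGoodReductionAtPrime p :=
      not_not.mp (mt (W.dvd_conductorNorm_iff_not_hasGoodReductionAtPrime p).mpr hgoodN)
    have h1 : (W.baseChange ℚ_[p]).localTamagawaNumber ℤ_[p] = 1 :=
      localTamagawaNumber_padic_eq_one_of_good_holds W p hgood
    rw [h1] at hpc
    exact hp.one_lt.ne' (Nat.dvd_one.mp hpc)
  have hp2split : ((Ideal.span {(p : ℤ)}).primesOver (𝓞 K)).ncard = 2 := hH p hp hpN
  obtain ⟨hT, hC⟩ :=
    CarrierLocalE0OddPrime.carrierLocalE0_ringClassField_of_odd_prime_dvd W K ι hK p hp hp2 hpc hp2split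
  exact hGZ_of_onlyMult_of_galTrivial_of_kills W K hK hD hH p hp5 hsurj honly hpN Dt β ι hc0 hT hC

/-- **`p ∣ c_p(E/ℚ_p)` on the S1b locus, from its binders** (`p ≥ 5`, `p` the only multiplicative prime, split at `p`, `p ∣ ∏_ℓ c_ℓ`):
the place of `p` is the unique split multiplicative place, so it carries all of `ord_p ∏c` (`CornerLocal.padicValNat_tamagawaNumberAt_eq_of_unique_split`;
additive `c_ℓ ≤ 4 < p`), and `c_p(E/ℚ_p) = c_{v_p}` (`localTamagawaNumber_padic_eq_holds`). [cite: SilvermanATAEC1994, IV Cor. 9.2 (d), Table 4.1] -/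
theorem dvd_localTamagawaNumber_padic_of_onlyMult_of_split_of_dvd_tamagawaProduct
    (W : WeierstrassCurve ℚ) [W.IsElliptic] [W.IsGloballyMinimal] (p : ℕ) [Fact p.Prime] (hp5 : 5 ≤ p)
    (honly : ∀ (ℓ : ℕ) [Fact ℓ.Prime], W.HasMultiplicativeReductionAtPrime ℓ → ℓ = p)
    (hsplit : W.HasSplitMultiplicativeReductionAtPrime p) (htam : p ∣ W.tamagawaProduct) :
    p ∣ (W.baseChange ℚ_[p]).localTamagawaNumber ℤ_[p] := by
  have hp : p.Prime := Fact.out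
  set v₀ : HeightOneSpectrum (𝓞 ℚ) := (Rat.HeightOneSpectrum.primesEquiv (R := 𝓞 ℚ)).symm ⟨p, hp⟩ with hv₀def
  have hv₀ : Rat.HeightOneSpectrum.primesEquiv v₀ = ⟨p, hp⟩ := Equiv.apply_symm_apply _ _
  -- the place of `p` is split multiplicative and the unique such place
  -- adapted from Summits/BirchSwinnertonDyer/BirchSwinnertonDyer/Theorems/ErratumRoadFiveEulerHalfPOnlyMultOfPrint.lean (`monoCarrier_of_onlyMult_of_split`)
  have hs : W.HasSplitMultiplicativeReductionAt v₀ := by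
    rw [← WeierstrassCurve.hasSplitMultiplicativeReductionAtPrime_iff_hasSplitMultiplicativeReductionAt W v₀]
    have key : ∀ (q : Nat.Primes), q = ⟨p, hp⟩ → (haveI := Fact.mk q.2; W.HasSplitMultiplicativeReductionAtPrime q) := by
      rintro q rfl
      exact hsplit
    exact key _ hv₀
  have huniq : ∀ v, W.HasSplitMultiplicativeReductionAt v → v = v₀ := fun v hv ↦ by
    have hm := (WeierstrassCurve.hasMultiplicativeReductionAtPrime_iff_hasMultiplicativeReductionAt_ringOfIntegers
      (W := W) v).mpr hv.hasMultiplicativeReductionAt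
    have hvp : (Rat.HeightOneSpectrum.primesEquiv v : ℕ) = p :=
      @honly _ (Fact.mk (Rat.HeightOneSpectrum.primesEquiv v).2) hm
    apply (Rat.HeightOneSpectrum.primesEquiv (R := 𝓞 ℚ)).injective
    rw [hv₀]
    exact Subtype.ext hvp
  -- `ord_p c_{v₀} = ord_p ∏c ≥ 1`
  have heq := CornerLocal.padicValNat_tamagawaNumberAt_eq_of_unique_split W p hp5 hs huniq
  have h1 : 1 ≤ padicValNat p W.tamagawaProduct := one_le_padicValNat_of_dvd W.tamagawaProduct_pos'.ne' htam
  rw [← heq] at h1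
  have hdvd : p ∣ W.tamagawaNumberAt v₀ := dvd_of_one_le_padicValNat h1
  -- `c_p(E/ℚ_p) = c_{v₀}`
  have hv₀' : ((Rat.HeightOneSpectrum.primesEquiv v₀ : Nat.Primes) : ℕ) = p := by rw [hv₀]
  rw [WeierstrassCurve.localTamagawaNumber_padic_eq_holds W v₀ p hv₀']
  exact hdvd

/-- **`hGZ` on the S1b rows in the S1b stub's OWN binders** (`p ∣ ∏_ℓ c_ℓ`, `p` the only multiplicative prime, split at `p` — the binders
`htam`, `honly`, `hsplit` of `stub_res_pOnlyMultCarrierAtFive_of_print`; `d_K < −4` the consumer derives from `Odd d_K ∧ d_K ≠ −3`):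
`hGZ_of_onlyMult` at `hpc := dvd_localTamagawaNumber_padic_of_onlyMult_of_split_of_dvd_tamagawaProduct`. [cite: GrossLMS1991, §6, p. 245] -/
theorem hGZ_of_onlyMult_of_split_of_dvd_tamagawaProduct
    (W : WeierstrassCurve ℚ) [W.IsElliptic] [W.IsGloballyMinimal] [NeZero (W.conductorNorm ℤ)]
    (K : Type) [Field K] [NumberField K] (hK : IsImaginaryQuadratic K) (hD : NumberField.discr K < -4)
    (hH : SatisfiesHeegnerHypothesis (W.conductorNorm ℤ) K) (p : ℕ) [Fact p.Prime] (hp5 : 5 ≤ p)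
    (hsurj : W.HasSurjectiveModNGaloisRep p)
    (honly : ∀ (ℓ : ℕ) [Fact ℓ.Prime], W.HasMultiplicativeReductionAtPrime ℓ → ℓ = p)
    (hsplit : W.HasSplitMultiplicativeReductionAtPrime p) (htam : p ∣ W.tamagawaProduct)
    (Dt : ModularParametrizationData W (W.conductorNorm ℤ)) (β : ℤ) (ι : K →+* ℂ)
    [∀ j : ℕ, NumberField (ringClassField K ι j)] :
    ∃ n' : ℤ, IsCoprime (p : ℤ) n' ∧ ∀ (m : ℕ), Squarefree m →
      (∀ q ∈ m.primeFactors, Zhang2014.IsKolyvaginPrime (W.conductorNorm ℤ) W K p q) →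
      ∀ (dm : KolyvaginHeegnerData Dt β ι m)
        (γ : ringClassField K ι m ≃ₐ[ℚ] ringClassField K ι m), γ ∈ ringClassGal ι m →
        ∀ v : HeightOneSpectrum (𝓞 K), ¬ (W.baseChange K).HasGoodReductionAt v →
          n' • pointsMap (W.baseChange K) (v.adicCompletion K)
              (dm.toGeomPoints (pointGalHom W (ringClassField K ι m) γ dm.y)) ∈
            E0Receptacle (W.baseChange K) v ∧
          ∀ (ℓ : ℕ), ℓ ∈ m.primeFactors → ∀ (dm' : KolyvaginHeegnerData Dt β ι (m / ℓ))
            (hle : ringClassField K ι (m / ℓ) ≤ ringClassField K ι m),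
            n' • pointsMap (W.baseChange K) (v.adicCompletion K)
                (dm.toGeomPoints (pointGalHom W (ringClassField K ι m) γ
                  (WeierstrassCurve.Affine.Point.map (W' := W)
                    ((RingClassField.inclusion ι hle).restrictScalars ℚ) dm'.y))) ∈
              E0Receptacle (W.baseChange K) v :=
  hGZ_of_onlyMult W K hK hD hH p hp5 hsurj honly
    (dvd_localTamagawaNumber_padic_of_onlyMult_of_split_of_dvd_tamagawaProduct W p hp5 honly hsplit htam) Dt β ι

end Summit.BirchSwinnertonDyer.BirchSwinnertonDyer.Theorems.ModularAuxNorm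

end
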